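import Summits.Ventures.PercRepro.Graph

/-!
# Cluster-determined events: `Q_W`, `R_X`

For a distinguished vertex `s` of the multigraph `G`:

* `G.connAllEvent s W` (= `Q_W` of van den Berg–Kahn): `s` is joined to every vertex of `W`;
* `G.sepAllEvent s X` (= `R_X`): `s` is joined to no vertex of `X`;
* `G.ClusterDet s D`: the event `D` is **`s`-cluster-determined**, i.e. increasing in the open
  cluster `C_s`: `ω ∈ D` and `C_s(ω) ⊆ C_s(ω')` imply `ω' ∈ D`.  Such events are increasing
  (`ClusterDet.isUpperSet`), closed under `∩` and `∪`, and are exactly the preimages of up-sets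
  of `Set V` under `ω ↦ C_s(ω)` (`clusterDet_iff`).  Examples: `Q_W`, `{s ↔ v}`, `{|C_s| ≥ k}`.

These are the events entering the conditional-correlation inequalities
(van den Berg–Kahn 2001, van den Berg–Häggström–Kahn 2006): `P(A ∩ R_X) P(B ∩ R_Y) ≤
P(A ∩ B ∩ R_{X ∩ Y}) P(R_{X ∪ Y})` for `s`-cluster-determined `A`, `B`.
-/

namespace PercRepro

namespace MultiGraph

variable {V E : Type*} (G : MultiGraph V E)

/-! ### `Q_W` and `R_X` -/

/-- `G.connAllEvent s W` (`Q_W`): `s` is connected to every vertex of `W`. -/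
def connAllEvent (s : V) (W : Set V) : Set (Config E) := {ω | ∀ w ∈ W, G.Conn ω s w}

/-- `G.sepAllEvent s X` (`R_X`): `s` is connected to no vertex of `X`. -/
def sepAllEvent (s : V) (X : Set V) : Set (Config E) := {ω | ∀ x ∈ X, ¬ G.Conn ω s x}

/-- Membership in `Q_W`. -/
theorem mem_connAllEvent {s : V} {W : Set V} {ω : Config E} :
    ω ∈ G.connAllEvent s W ↔ ∀ w ∈ W, G.Conn ω s w :=
  Iff.rfl

/-- Membership in `R_X`. -/
theorem mem_sepAllEvent {s : V} {X : Set V} {ω : Config E} :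
    ω ∈ G.sepAllEvent s X ↔ ∀ x ∈ X, ¬ G.Conn ω s x :=
  Iff.rfl

/-- `Q_W = {ω | W ⊆ C_s(ω)}`. -/
theorem connAllEvent_eq (s : V) (W : Set V) :
    G.connAllEvent s W = {ω | W ⊆ G.cluster ω s} :=
  Set.ext fun _ => Iff.rfl

/-- `R_X = {ω | X ∩ C_s(ω) = ∅}`. -/
theorem sepAllEvent_eq (s : V) (X : Set V) :
    G.sepAllEvent s X = {ω | Disjoint X (G.cluster ω s)} := by
  ext ω
  simp [sepAllEvent, Set.disjoint_left]

/-- `Q_W` is increasing. -/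
theorem isUpperSet_connAllEvent (s : V) (W : Set V) : IsUpperSet (G.connAllEvent s W) :=
  fun _ _ h hω w hw => Conn.mono h (hω w hw)

/-- `R_X` is decreasing. -/
theorem isLowerSet_sepAllEvent (s : V) (X : Set V) : IsLowerSet (G.sepAllEvent s X) :=
  fun _ _ h hω x hx hc => hω x hx (Conn.mono h hc)

/-- `Q_∅` is the sure event. -/
@[simp] theorem connAllEvent_empty (s : V) : G.connAllEvent s ∅ = Set.univ := by
  ext ω
  simp [connAllEvent]

/-- `R_∅` is the sure event. -/
@[simp] theorem sepAllEvent_empty (s : V) : G.sepAllEvent s ∅ = Set.univ := by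
  ext ω
  simp [sepAllEvent]

/-- `Q_{W₁ ∪ W₂} = Q_{W₁} ∩ Q_{W₂}`. -/
theorem connAllEvent_union (s : V) (W₁ W₂ : Set V) :
    G.connAllEvent s (W₁ ∪ W₂) = G.connAllEvent s W₁ ∩ G.connAllEvent s W₂ := by
  ext ω
  simp only [mem_connAllEvent, Set.mem_union, Set.mem_inter_iff]
  exact ⟨fun h => ⟨fun w hw => h w (Or.inl hw), fun w hw => h w (Or.inr hw)⟩,
    fun h w hw => hw.elim (h.1 w) (h.2 w)⟩

/-- `R_{X ∪ Y} = R_X ∩ R_Y`. -/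
theorem sepAllEvent_union (s : V) (X Y : Set V) :
    G.sepAllEvent s (X ∪ Y) = G.sepAllEvent s X ∩ G.sepAllEvent s Y := by
  ext ω
  simp only [mem_sepAllEvent, Set.mem_union, Set.mem_inter_iff]
  exact ⟨fun h => ⟨fun x hx => h x (Or.inl hx), fun x hx => h x (Or.inr hx)⟩,
    fun h x hx => hx.elim (h.1 x) (h.2 x)⟩

/-- `Q_W` is antitone in `W`. -/
theorem connAllEvent_anti (s : V) {W₁ W₂ : Set V} (h : W₁ ⊆ W₂) :
    G.connAllEvent s W₂ ⊆ G.connAllEvent s W₁ :=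
  fun _ hω w hw => hω w (h hw)

/-- `R_X` is antitone in `X`. -/
theorem sepAllEvent_anti (s : V) {X Y : Set V} (h : X ⊆ Y) :
    G.sepAllEvent s Y ⊆ G.sepAllEvent s X :=
  fun _ hω x hx => hω x (h hx)

/-- `Q_{w} = {s ↔ w}`. -/
theorem connAllEvent_singleton (s w : V) : G.connAllEvent s {w} = G.connEvent s w := by
  ext ω
  simp [connAllEvent, connEvent]

/-- `R_{x} = {s ↮ x}`. -/
theorem sepAllEvent_singleton (s x : V) : G.sepAllEvent s {x} = G.sepEvent s x := by
  ext ω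
  simp [sepAllEvent, sepEvent, connEvent]

/-- `R_X = ∅` when `s ∈ X`. -/
theorem sepAllEvent_eq_empty_of_mem {s : V} {X : Set V} (hs : s ∈ X) :
    G.sepAllEvent s X = ∅ := by
  ext ω
  simp only [mem_sepAllEvent, Set.mem_empty_iff_false, iff_false, not_forall, not_not]
  exact ⟨s, hs, Conn.refl G ω s⟩

/-- Adding `s` itself to `W` does not change `Q_W`. -/
theorem connAllEvent_insert_self (s : V) (W : Set V) :
    G.connAllEvent s (insert s W) = G.connAllEvent s W := by
  ext ω
  simp only [mem_connAllEvent, Set.mem_insert_iff, forall_eq_or_imp]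
  exact ⟨fun h => h.2, fun h => ⟨Conn.refl G ω s, h⟩⟩

/-- `Q_W ∩ R_X = ∅` when `W` and `X` meet. -/
theorem connAllEvent_inter_sepAllEvent_eq_empty {s : V} {W X : Set V}
    (h : ¬ Disjoint W X) : G.connAllEvent s W ∩ G.sepAllEvent s X = ∅ := by
  ext ω
  simp only [Set.mem_inter_iff, mem_connAllEvent, mem_sepAllEvent, Set.mem_empty_iff_false,
    iff_false, not_and]
  intro hW hX
  apply h
  rw [Set.disjoint_left]
  intro v hvW hvX
  exact hX v hvX (hW v hvW)

/-! ### Cluster-determined events -/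

/-- `G.ClusterDet s D`: the event `D` is **`s`-cluster-determined**, i.e. increasing in the open
cluster of `s`: `ω ∈ D` and `C_s(ω) ⊆ C_s(ω')` imply `ω' ∈ D`. -/
def ClusterDet (s : V) (D : Set (Config E)) : Prop :=
  ∀ ⦃ω ω' : Config E⦄, G.cluster ω s ⊆ G.cluster ω' s → ω ∈ D → ω' ∈ D

variable {G}

/-- A cluster-determined event is increasing. -/
theorem ClusterDet.isUpperSet {s : V} {D : Set (Config E)} (h : G.ClusterDet s D) :
    IsUpperSet D :=
  fun _ _ hle hω => h (G.cluster_mono hle s) hω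

/-- Intersections of cluster-determined events are cluster-determined. -/
theorem ClusterDet.inter {s : V} {A B : Set (Config E)} (hA : G.ClusterDet s A)
    (hB : G.ClusterDet s B) : G.ClusterDet s (A ∩ B) :=
  fun _ _ h hω => ⟨hA h hω.1, hB h hω.2⟩

/-- Unions of cluster-determined events are cluster-determined. -/
theorem ClusterDet.union {s : V} {A B : Set (Config E)} (hA : G.ClusterDet s A)
    (hB : G.ClusterDet s B) : G.ClusterDet s (A ∪ B) :=
  fun _ _ h hω => hω.elim (fun hA' => Or.inl (hA h hA')) fun hB' => Or.inr (hB h hB')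

/-- A cluster-determined event is invariant under changing `ω` without changing `C_s`. -/
theorem ClusterDet.mem_iff_of_eq {s : V} {D : Set (Config E)} (h : G.ClusterDet s D)
    {ω ω' : Config E} (hc : G.cluster ω s = G.cluster ω' s) : ω ∈ D ↔ ω' ∈ D :=
  ⟨h hc.subset, h hc.symm.subset⟩

variable (G)

/-- The sure event is cluster-determined. -/
theorem clusterDet_univ (s : V) : G.ClusterDet s Set.univ := fun _ _ _ _ => trivial

/-- The impossible event is cluster-determined. -/
theorem clusterDet_empty (s : V) : G.ClusterDet s ∅ := fun _ _ _ h => h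

/-- `Q_W` is cluster-determined. -/
theorem clusterDet_connAllEvent (s : V) (W : Set V) : G.ClusterDet s (G.connAllEvent s W) :=
  fun _ _ h hω w hw => h (hω w hw)

/-- `{s ↔ v}` is cluster-determined. -/
theorem clusterDet_connEvent (s v : V) : G.ClusterDet s (G.connEvent s v) := by
  rw [← connAllEvent_singleton]
  exact G.clusterDet_connAllEvent s {v}

/-- `{|C_s| ≥ k}` is cluster-determined (finite vertex set). -/
theorem clusterDet_ncard_ge [Finite V] (s : V) (k : ℕ) :
    G.ClusterDet s {ω | k ≤ (G.cluster ω s).ncard} :=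
  fun _ _ h hω => le_trans hω (Set.ncard_le_ncard h)

/-- Cluster-determined events are exactly the preimages of up-sets of `Set V` under
`ω ↦ C_s(ω)`. -/
theorem clusterDet_iff (s : V) (D : Set (Config E)) :
    G.ClusterDet s D ↔
      ∃ F : Set (Set V), IsUpperSet F ∧ D = (fun ω => G.cluster ω s) ⁻¹' F := by
  constructor
  · intro h
    refine ⟨{C | ∃ ω ∈ D, G.cluster ω s ⊆ C}, ?_, ?_⟩
    · rintro C C' hCC' ⟨ω, hω, hC⟩
      exact ⟨ω, hω, hC.trans hCC'⟩
    · ext ω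
      simp only [Set.mem_preimage, Set.mem_setOf_eq]
      exact ⟨fun hω => ⟨ω, hω, subset_rfl⟩, fun ⟨ω₀, hω₀, hsub⟩ => h hsub hω₀⟩
  · rintro ⟨F, hF, rfl⟩ ω ω' h hω
    exact hF h hω

end MultiGraph

end PercRepro
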